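import Literature.Topology.FourManifolds.TorusCurveTubes
import Literature.Topology.FourManifolds.ToricBlowupPolar
import HarnessLib

/-!
# Plumbing coordinates of the thin-arc tubes at a flat spot

Topic `Literature/Topology/FourManifolds` (fact seat of the Seiberg–Witten leaf
`Literature.Barriers.SmoothPoincare4.akhmedovPark2010_lemma8_invariants`; block 2 of
Akhmedov–Park's `X₁(m)`, A. Akhmedov, B. D. Park, Invent. Math. 181 (2010), §3).  Near its two
plumbing points the tube of the braided torus `T_β` (`BraidedTorusSheet.lean`) is
`T₂ (w, v) = e⁻¹ ((into (x⋆ · A v), σ²), τ)` with the thin arcs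
`A v = (e^{i δ arctan(v₀)/2}, e^{i δ arctan(v₁)/2})` (`braidMap_flat`), and the local models are
read in the plumbing chart `P` built from the quarter-arc chart `eF` of the torus centred at `x⋆`
with scale `c′` and the scale `c` in the `T²`-factor (`exists_torusQuarterChart`,
`exists_plumbingChart`).  This file computes, from the FORMULAS of `eF` and `P` taken as
hypotheses, the plumbing coordinates of such a point:

  `toC2 (P x) = (c′ (tan (δ arctan v₀) + i tan (δ arctan v₁)), c (Im s/Re s + i Im t/Re t))`

for `e x = ((into (x⋆ · A v), s), t)` (`toC2_plumbing_of_thinArc`), together with the membership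
`x ∈ P.source ↔ 0 < Re s ∧ 0 < Re t` (the thin arcs always lie in the quarter arcs, `0 ≤ δ ≤ 1`).
Everything is proved; no definitions.

## References

* A. Akhmedov, B. D. Park, Invent. Math. 181 (2010) 577–603 = arXiv:math/0701829, §3. [AkhmedovPark2010]
-/

noncomputable section

open scoped Manifold ContDiff Topology Real
open Set Function Complex
open Literature.Geometry.Manifold (Rechart)
open Literature.Topology.FourManifolds.ToricBlowup

namespace Literature.Topology.FourManifolds

namespace ThinArcPlumbing

/-- The square of the half-angle arc point and its quarter coordinate:
`(e^{i s/2})² = e^{i s}`, `Im/Re = tan s`, and both `e^{i s/2}`, `e^{i s}` have positive real part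
for `|s| < π/2`. [folklore] -/
theorem circleExp_half_facts {s : ℝ} (hs : |s| < π / 2) (θ : Circle) :
    ((((θ * Circle.exp (s / 2)) * θ⁻¹ : Circle) : ℂ) ^ 2).im /
        ((((θ * Circle.exp (s / 2)) * θ⁻¹ : Circle) : ℂ) ^ 2).re = Real.tan s ∧
      0 < ((((θ * Circle.exp (s / 2)) * θ⁻¹ : Circle) : ℂ)).re ∧
      0 < ((((θ * Circle.exp (s / 2)) * θ⁻¹ : Circle) : ℂ) ^ 2).re := by
  rw [mul_inv_cancel_comm]
  have h2 : ((Circle.exp (s / 2) : Circle) : ℂ) ^ 2 = ((Circle.exp s : Circle) : ℂ) := by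
    rw [sq, ← Circle.coe_mul, ← Circle.exp_add, add_halves]
  obtain ⟨h1, h1'⟩ := abs_lt.1 hs
  have hπ := Real.pi_pos
  refine ⟨?_, ?_, ?_⟩
  · rw [h2, Circle.coe_exp, Complex.exp_ofReal_mul_I_re, Complex.exp_ofReal_mul_I_im,
      Real.tan_eq_sin_div_cos]
  · rw [Circle.coe_exp, Complex.exp_ofReal_mul_I_re]
    exact Real.cos_pos_of_mem_Ioo ⟨by linarith, by linarith⟩
  · rw [h2, Circle.coe_exp, Complex.exp_ofReal_mul_I_re]
    exact Real.cos_pos_of_mem_Ioo ⟨by linarith, by linarith⟩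

/-- `|δ arctan t| < π/2` for `0 ≤ δ ≤ 1`. [folklore] -/
theorem abs_mul_arctan_lt {δ : ℝ} (hδ : 0 ≤ δ) (hδ1 : δ ≤ 1) (t : ℝ) : |δ * Real.arctan t| < π / 2 := by
  have h1 := Real.arctan_lt_pi_div_two t
  have h2 := Real.neg_pi_div_two_lt_arctan t
  have hπ := Real.pi_pos
  have : |Real.arctan t| < π / 2 := abs_lt.2 ⟨h2, h1⟩
  rw [abs_mul, abs_of_nonneg hδ]
  calc δ * |Real.arctan t| ≤ 1 * |Real.arctan t| :=
        mul_le_mul_of_nonneg_right hδ1 (abs_nonneg _)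
    _ < π / 2 := by rw [one_mul]; exact this

variable {f : ModelProd (EuclideanSpace ℝ (Fin 1)) (EuclideanSpace ℝ (Fin 1)) ≃ₜ EuclideanSpace ℝ (Fin 2)}
  {X : Type*} [TopologicalSpace X]
  {e : X ≃ₜ (Rechart f (Circle × Circle) × Circle) × Circle}
  {eF : OpenPartialHomeomorph (Rechart f (Circle × Circle)) (EuclideanSpace ℝ (Fin 2))}
  {P : OpenPartialHomeomorph X (EuclideanSpace ℝ (Fin 4))}
  {A : EuclideanSpace ℝ (Fin 2) → Circle × Circle} {xs : Circle × Circle} {c c' δ : ℝ}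

/-- **Plumbing coordinates of a point of a thin-arc tube at a flat spot.**  With the thin arcs
`A v = (e^{i δ arctan(v₀)/2}, e^{i δ arctan(v₁)/2})` (`0 ≤ δ ≤ 1`), the quarter-arc chart `eF` of the
torus centred at `x⋆` with scale `c′` (its source and formula as delivered by
`exists_torusQuarterChart`) and the plumbing chart `P` of `X` built from `eF` and the scale `c` (its
source and formula as delivered by `exists_plumbingChart`): a point `x` with
`e x = ((into (x⋆ · A v), s), t)` lies in `P.source` iff `Re s > 0` and `Re t > 0`, and then has
plumbing coordinates `toC2 (P x) = (c′ (tan (δ arctan v₀) + i tan (δ arctan v₁)), c (Im s/Re s + i Im t/Re t))`.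
[cite: AkhmedovPark2010, §3] -/
theorem toC2_plumbing_of_thinArc (hδ : 0 ≤ δ) (hδ1 : δ ≤ 1)
    (hA : ∀ v : EuclideanSpace ℝ (Fin 2),
      A v = (Circle.exp (δ * Real.arctan (v 0) / 2), Circle.exp (δ * Real.arctan (v 1) / 2)))
    (heFs : eF.source = {x | (0 < ((((Rechart.out f (Circle × Circle) x).1 * xs.1⁻¹ : Circle) : ℂ)).re ∧
        0 < ((((Rechart.out f (Circle × Circle) x).1 * xs.1⁻¹ : Circle) : ℂ) ^ 2).re) ∧
      (0 < ((((Rechart.out f (Circle × Circle) x).2 * xs.2⁻¹ : Circle) : ℂ)).re ∧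
        0 < ((((Rechart.out f (Circle × Circle) x).2 * xs.2⁻¹ : Circle) : ℂ) ^ 2).re)})
    (heFv : ∀ x, eF x 0 = c' * ((((((Rechart.out f (Circle × Circle) x).1 * xs.1⁻¹ : Circle) : ℂ) ^ 2).im /
        ((((Rechart.out f (Circle × Circle) x).1 * xs.1⁻¹ : Circle) : ℂ) ^ 2).re)) ∧
      eF x 1 = c' * ((((((Rechart.out f (Circle × Circle) x).2 * xs.2⁻¹ : Circle) : ℂ) ^ 2).im /
        ((((Rechart.out f (Circle × Circle) x).2 * xs.2⁻¹ : Circle) : ℂ) ^ 2).re)))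
    (hPs : P.source = {x | (e x).1.1 ∈ eF.source ∧ 0 < (((e x).1.2 : Circle) : ℂ).re ∧
      0 < (((e x).2 : Circle) : ℂ).re})
    (hPv : ∀ x, toC2 (P x) = ((⟨eF (e x).1.1 0, eF (e x).1.1 1⟩ : ℂ),
      (⟨c * ((((e x).1.2 : Circle) : ℂ).im / (((e x).1.2 : Circle) : ℂ).re),
        c * ((((e x).2 : Circle) : ℂ).im / (((e x).2 : Circle) : ℂ).re)⟩ : ℂ)))
    {x : X} {v : EuclideanSpace ℝ (Fin 2)} {s t : Circle}
    (hx : e x = ((Rechart.into f (Circle × Circle) (xs * A v), s), t)) :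
    (x ∈ P.source ↔ 0 < ((s : ℂ)).re ∧ 0 < ((t : ℂ)).re) ∧
      toC2 (P x) = ((⟨c' * Real.tan (δ * Real.arctan (v 0)), c' * Real.tan (δ * Real.arctan (v 1))⟩ : ℂ),
        (⟨c * (((s : ℂ)).im / ((s : ℂ)).re), c * (((t : ℂ)).im / ((t : ℂ)).re)⟩ : ℂ)) := by
  have h11 : (e x).1.1 = Rechart.into f (Circle × Circle) (xs * A v) := by rw [hx]
  have h12 : (e x).1.2 = s := by rw [hx]
  have h2 : (e x).2 = t := by rw [hx]
  have hout : Rechart.out f (Circle × Circle) (e x).1.1 = xs * A v := by rw [h11, Rechart.out_into]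
  have hA0 : (xs * A v).1 = xs.1 * Circle.exp (δ * Real.arctan (v 0) / 2) := by rw [hA]; rfl
  have hA1 : (xs * A v).2 = xs.2 * Circle.exp (δ * Real.arctan (v 1) / 2) := by rw [hA]; rfl
  obtain ⟨t0, p0, q0⟩ := circleExp_half_facts (abs_mul_arctan_lt hδ hδ1 (v 0)) xs.1
  obtain ⟨t1, p1, q1⟩ := circleExp_half_facts (abs_mul_arctan_lt hδ hδ1 (v 1)) xs.2
  have hmem : (e x).1.1 ∈ eF.source := by
    rw [heFs]
    show (0 < ((((Rechart.out f (Circle × Circle) (e x).1.1).1 * xs.1⁻¹ : Circle) : ℂ)).re ∧ _) ∧ _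
    rw [hout, hA0, hA1]
    exact ⟨⟨p0, q0⟩, ⟨p1, q1⟩⟩
  constructor
  · rw [hPs]
    show ((e x).1.1 ∈ eF.source ∧ 0 < (((e x).1.2 : Circle) : ℂ).re ∧ 0 < (((e x).2 : Circle) : ℂ).re) ↔ _
    rw [h12, h2]
    exact ⟨fun h => ⟨h.2.1, h.2.2⟩, fun h => ⟨hmem, h.1, h.2⟩⟩
  · rw [hPv, h12, h2]
    obtain ⟨e0, e1⟩ := heFv (e x).1.1
    rw [e0, e1, hout, hA0, hA1, t0, t1]

end ThinArcPlumbing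

end Literature.Topology.FourManifolds
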